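import Summits.QuantumFields.YangMills.Theorems.EquipartitionCriticalityEquipartitionPinsProbeSecondDifference
import Summits.QuantumFields.YangMills.Theorems.EquipartitionCriticalityEquipartitionPinsProbeAxisFourier
import Summits.QuantumFields.YangMills.Theorems.EquipartitionCriticalityEquipartitionPinsProbePoissonIntegral
import Summits.QuantumFields.YangMills.Theorems.EquipartitionCriticalityEquipartitionPinsProbeProfile
import Literature.MathematicalPhysics.QuantumFieldTheory.CurvatureGaussianField
import HarnessLib

/-!
# The in-plane axial lattice-Maxwell plaquette kernel: sign and polynomial lower bound

Support file for the statement item `stmt-QuantumFields-12314`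
(`Summit.QuantumFields.YangMills.Theses.DirichletWindow.LocalGaussianity`), line «exp-moment tangent law»
(reduction `Theorems/DirichletWindowLocalGaussianityExpMomentTangentLaw.lean`), input `KernelLower` of
`Theorems/DirichletWindowFixedDistanceLowerPsdTransfer.lean`.  Route-independent content (no `Theses` import):

* `AxialKernel.curvatureTwoPoint_inPlane_eq_neg_corr` — for `n ≠ 0` the IN-PLANE axial kernel of the lattice
  Maxwell field strength, `c'_n = curvatureTwoPoint (0; 0,1) (n e₀; 0,1)`, is MINUS the out-of-plane kernel
  `c_n = curvaturePlaquetteCorr 4 n = curvatureTwoPoint (0; 1,2) (n e₀; 1,2)`: both are combinations of second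
  differences of the lattice Green function at `n e₀` (`c'_n = −½(Δ₀+Δ₁)G`, `c_n = −½(Δ₁+Δ₂)G`,
  `G = latticeGreen`), and harmonicity off the origin (`(Δ₀ + 3Δ_⊥)G(n e₀) = 0`, transverse symmetry) gives
  `c'_n = −c_n = −(1/3)Δ₀G(n e₀)` (sixteen-term expansion as in `EquipartitionPinsProbe.stub_secondDifference`).
* `AxialKernel.klIntegral_ge` — a POLYNOMIAL lower bound for the Källén–Lehmann integral
  `J_n = ∫_{[-π,π]³} √(ε/(ε+2)) (1 + ε − √(ε(ε+2)))ⁿ dk ≥ 1/(32768 n⁴)` (`n ≥ 1`): restrict to the cube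
  `[1/(8n), 1/(4n)]³`, on which `ε ≍ n⁻²`, the weight is `≥ 1/(24 n)` and the ratio to the `n`-th power is
  `≥ 3/8` (Bernoulli).  (The tree's `stub_profile` only records the sub-exponential bound `C_ε e^{−εn}`.)
* `AxialKernel.corr_ge` — hence `c_n ≥ κ₀/n⁴`, `κ₀ = (2/3)(2π)⁻³/32768`, via the Fourier representation
  `c_n = (2/3)(2π)⁻³ J_n` (`stub_secondDifference`, `stub_axisFourier`, `stub_poissonIntegral`), and
  `|c'_n| ≥ κ₀/n⁴`.

The true asymptotics is `c_n ∼ 1/(π² n⁴)` (Laplace's method; Lawler–Limic 2010 §4.3); only the order of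
magnitude is needed downstream.  Elementary real analysis ([folklore]).
-/

noncomputable section

open MeasureTheory
open Literature.MathematicalPhysics.QuantumFieldTheory Literature.Probability.LatticeModels
open Literature.MathematicalPhysics.QuantumLattice

namespace Summit.QuantumFields.YangMills.Theorems.LocalGaussianityExpMomentTangentLaw

namespace AxialKernel

/-! ### The in-plane kernel is minus the out-of-plane kernel -/

/-- The sixteen-term expansion of the in-plane axial kernel: with `z = n e₀`,
`curvatureTwoPoint (0;0,1) (z;0,1) = 2G(z) − ½(G(z+e₀) + G(z−e₀) + G(z+e₁) + G(z−e₁))`, `G = latticeGreen`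
(only equal-direction edge pairs contribute; evenness of `G`). -/
theorem curvatureTwoPoint_inPlane_eq_sixteen (n : ℤ) :
    curvatureTwoPoint (((0 : Site 4), ⟨((0 : Fin 4), (1 : Fin 4)), Fin.zero_lt_one⟩) : ZdPlaquette 4)
      (((Pi.single (0 : Fin 4) n : Site 4)), ⟨((0 : Fin 4), (1 : Fin 4)), Fin.zero_lt_one⟩) =
      2 * latticeGreen (Pi.single (0 : Fin 4) n : Site 4)
        - latticeGreen ((Pi.single (0 : Fin 4) n : Site 4) + Pi.single 0 1) / 2
        - latticeGreen ((Pi.single (0 : Fin 4) n : Site 4) - Pi.single 0 1) / 2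
        - latticeGreen ((Pi.single (0 : Fin 4) n : Site 4) + Pi.single 1 1) / 2
        - latticeGreen ((Pi.single (0 : Fin 4) n : Site 4) - Pi.single 1 1) / 2 := by
  simp only [curvatureTwoPoint, Fin.sum_univ_four, plaquetteBoundary,
    plaquetteBoundarySign, edgeGreen, Matrix.cons_val_zero, Matrix.cons_val_one,
    Matrix.cons_val, if_true, show (0 : Fin 4) ≠ 1 from by decide,
    show (1 : Fin 4) ≠ 0 from by decide, if_false]
  set z : Site 4 := Pi.single (0 : Fin 4) n with hz
  have h1 : (0 : Site 4) - z = -z := zero_sub z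
  have h2 : (0 : Site 4) - (z + Pi.single 0 1) = -(z + Pi.single 0 1) := zero_sub _
  have h3 : (0 : Site 4) - (z + Pi.single 1 1) = -(z + Pi.single 1 1) := zero_sub _
  have h4 : (0 : Site 4) + Pi.single 0 1 - (z + Pi.single 0 1) = -z := by abel
  have h5 : (0 : Site 4) + Pi.single 0 1 - z = -(z - Pi.single 0 1) := by abel
  have h6 : (0 : Site 4) + Pi.single 1 1 - z = -(z - Pi.single 1 1) := by abel
  have h7 : (0 : Site 4) + Pi.single 1 1 - (z + Pi.single 1 1) = -z := by abel
  rw [h1, h2, h3, h4, h5, h6, h7]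
  simp only [latticeGreen_neg]
  ring

/-- **The in-plane axial kernel is minus the out-of-plane one**: for `n ≠ 0`,
`curvatureTwoPoint (0;0,1) (n e₀;0,1) = − curvaturePlaquetteCorr 4 n` (sixteen-term expansion, transverse
symmetry of the axis Green function, harmonicity off the origin, and `stub_secondDifference`). -/
theorem curvatureTwoPoint_inPlane_eq_neg_corr (n : ℤ) (hn : n ≠ 0) :
    curvatureTwoPoint (((0 : Site 4), ⟨((0 : Fin 4), (1 : Fin 4)), Fin.zero_lt_one⟩) : ZdPlaquette 4)
      (((Pi.single (0 : Fin 4) n : Site 4)), ⟨((0 : Fin 4), (1 : Fin 4)), Fin.zero_lt_one⟩) =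
      -curvaturePlaquetteCorr (d := 4) (by norm_num) n := by
  rw [curvatureTwoPoint_inPlane_eq_sixteen,
    Summit.QuantumFields.YangMills.Theorems.EquipartitionPinsProbe.stub_secondDifference n hn]
  set z : Site 4 := Pi.single (0 : Fin 4) n with hz
  have hz0 : z ≠ 0 := by
    intro h
    have := congrFun h 0
    simp [hz] at this
    exact hn this
  -- harmonicity off the origin: Σᵢ (G(z+eᵢ) + G(z−eᵢ)) − 8 G(z) = 0
  have hharm := latticeLaplacianZd_latticeGreen_of_ne_zero (d := 4) (by norm_num) hz0
  rw [latticeLaplacianZd, Fin.sum_univ_four] at hharm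
  -- transverse symmetry
  have s2p : latticeGreen (z + Pi.single 2 1) = latticeGreen (z + Pi.single 1 1) :=
    EquipartitionPinsProbe.SecondDifference.latticeGreen_axis_add_single n 1 (by decide) (by decide)
  have s3p : latticeGreen (z + Pi.single 3 1) = latticeGreen (z + Pi.single 1 1) :=
    EquipartitionPinsProbe.SecondDifference.latticeGreen_axis_add_single n 1 (by decide) (by decide)
  have s2m : latticeGreen (z - Pi.single 2 1) = latticeGreen (z - Pi.single 1 1) := by
    have h := EquipartitionPinsProbe.SecondDifference.latticeGreen_axis_add_single n (-1) (i := 2) (j := 1)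
      (by decide) (by decide)
    simpa only [Pi.single_neg, ← sub_eq_add_neg] using h
  have s3m : latticeGreen (z - Pi.single 3 1) = latticeGreen (z - Pi.single 1 1) := by
    have h := EquipartitionPinsProbe.SecondDifference.latticeGreen_axis_add_single n (-1) (i := 3) (j := 1)
      (by decide) (by decide)
    simpa only [Pi.single_neg, ← sub_eq_add_neg] using h
  -- axial neighbours
  have ap : z + Pi.single 0 1 = Pi.single (0 : Fin 4) (n + 1) := by
    rw [hz, ← Pi.single_add]
  have am : z - Pi.single 0 1 = Pi.single (0 : Fin 4) (n - 1) := by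
    rw [hz, ← Pi.single_sub]
  rw [s2p, s3p, s2m, s3m, ap, am] at hharm
  rw [ap, am]
  have h8 : (2 : ℝ) * (4 : ℕ) = 8 := by norm_num
  rw [h8] at hharm
  linarith

/-! ### A polynomial lower bound for the Källén–Lehmann integral -/

/-- `1 − cos t ≥ t²/5` for `|t| ≤ π` (from `cos t ≤ 1 − (2/π²) t²` and `π² ≤ 10`). -/
theorem sq_div_five_le_one_sub_cos {t : ℝ} (ht : |t| ≤ Real.pi) : t ^ 2 / 5 ≤ 1 - Real.cos t := by
  have h := Real.cos_le_one_sub_mul_cos_sq ht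
  have hπ : Real.pi ^ 2 ≤ 10 := by nlinarith [Real.pi_lt_d2, Real.pi_pos]
  have hπ0 : 0 < Real.pi ^ 2 := by positivity
  have h2 : t ^ 2 / 5 ≤ 2 / Real.pi ^ 2 * t ^ 2 := by
    rw [div_mul_eq_mul_div, le_div_iff₀ hπ0]
    have := mul_le_mul_of_nonneg_left hπ (by positivity : (0:ℝ) ≤ t ^ 2 / 5)
    linarith
  linarith

/-- **Polynomial lower bound for the Källén–Lehmann integral**: for `n ≥ 1`,
`J_n = ∫_{[-π,π]³} √(ε/(ε+2)) (1 + ε − √(ε(ε+2)))ⁿ dk ≥ 1/(32768 n⁴)` (restriction to the cube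
`[1/(8n), 1/(4n)]³`). -/
theorem klIntegral_ge (n : ℕ) (hn : 1 ≤ n) :
    1 / (32768 * (n : ℝ) ^ 4) ≤
      ∫ k in brillouin 3, Real.sqrt (dispersion k / (dispersion k + 2)) *
        (1 + dispersion k - Real.sqrt (dispersion k * (dispersion k + 2))) ^ n := by
  set w : (Fin 3 → ℝ) → ℝ := fun k => Real.sqrt (dispersion k / (dispersion k + 2)) with hw
  set r : (Fin 3 → ℝ) → ℝ := fun k =>
    1 + dispersion k - Real.sqrt (dispersion k * (dispersion k + 2)) with hr
  show 1 / (32768 * (n : ℝ) ^ 4) ≤ ∫ k in brillouin 3, w k * r k ^ n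
  have hn0 : (0 : ℝ) < n := by exact_mod_cast hn
  have hn1 : (1 : ℝ) ≤ n := by exact_mod_cast hn
  set δ : ℝ := 1 / (8 * n) with hδ
  have hδpos : 0 < δ := by positivity
  have hnδ : (n : ℝ) * δ = 1 / 8 := by rw [hδ]; field_simp
  have hδle : δ ≤ 1 / 8 := by
    rw [hδ, div_le_div_iff_of_pos_left one_pos (by positivity) (by norm_num)]
    linarith
  -- the cube
  obtain ⟨Q, hQ⟩ : ∃ Q : Set (Fin 3 → ℝ), Q = Set.pi Set.univ fun _ => Set.Icc δ (2 * δ) :=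
    ⟨_, rfl⟩
  have hQmeas : MeasurableSet Q := hQ ▸ MeasurableSet.univ_pi fun _ => measurableSet_Icc
  have hQcpt : IsCompact Q := hQ ▸ isCompact_univ_pi fun _ => isCompact_Icc
  have hQmem : ∀ k ∈ Q, ∀ i, δ ≤ k i ∧ k i ≤ 2 * δ := fun k hk i => by
    rw [hQ] at hk
    exact Set.mem_univ_pi.1 hk i
  have hQsub : Q ⊆ brillouin 3 := fun k hk => Set.mem_univ_pi.2 fun i =>
    ⟨by linarith [(hQmem k hk i).1, Real.pi_pos], by linarith [(hQmem k hk i).2, Real.pi_gt_three]⟩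
  -- the dispersion on the cube
  have hE0 : ∀ k : Fin 3 → ℝ, 0 ≤ dispersion k := fun k => dispersion_nonneg k
  have hElb : ∀ k ∈ Q, 3 * (δ ^ 2 / 5) ≤ dispersion k := fun k hk => by
    have h : ∀ i, δ ^ 2 / 5 ≤ 1 - Real.cos (k i) := fun i => by
      have hi := hQmem k hk i
      have habs : |k i| ≤ Real.pi := by
        rw [abs_of_nonneg (by linarith)]
        linarith [Real.pi_gt_three]
      have hsq : δ ^ 2 ≤ k i ^ 2 := pow_le_pow_left₀ hδpos.le hi.1 2
      have := sq_div_five_le_one_sub_cos habs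
      linarith [div_le_div_of_nonneg_right hsq (by norm_num : (0:ℝ) ≤ 5)]
    simp only [dispersion, Fin.sum_univ_three]
    linarith [h 0, h 1, h 2]
  have hEub : ∀ k ∈ Q, dispersion k ≤ 6 * δ ^ 2 := fun k hk => by
    have h : ∀ i, 1 - Real.cos (k i) ≤ 2 * δ ^ 2 := fun i => by
      have hi := hQmem k hk i
      have hsq : k i ^ 2 ≤ (2 * δ) ^ 2 := pow_le_pow_left₀ (by linarith) hi.2 2
      linarith [Real.one_sub_sq_div_two_le_cos (x := k i)]
    simp only [dispersion, Fin.sum_univ_three]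
    linarith [h 0, h 1, h 2]
  have hE1 : ∀ k ∈ Q, dispersion k ≤ 1 := fun k hk => by
    have := hEub k hk
    nlinarith
  -- the weight on the cube: `w ≥ δ/3`
  have hwlb : ∀ k ∈ Q, δ / 3 ≤ w k := fun k hk => by
    have hE := hElb k hk
    have hE1' := hE1 k hk
    simp only [hw]
    refine Real.le_sqrt_of_sq_le ?_
    rw [le_div_iff₀ (by linarith [hE0 k])]
    nlinarith
  -- the ratio on the cube: `r ≥ 1 − 5δ ≥ 0`, hence `rⁿ ≥ 3/8`
  have hrlb : ∀ k ∈ Q, 1 - 5 * δ ≤ r k := fun k hk => by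
    have hE := hEub k hk
    have hE1' := hE1 k hk
    have hE0' := hE0 k
    simp only [hr]
    have hs : Real.sqrt (dispersion k * (dispersion k + 2)) ≤ 5 * δ := by
      rw [Real.sqrt_le_left (by positivity)]
      nlinarith
    linarith
  have h5δ : 5 * δ ≤ 5 / 8 := by linarith
  have hrn : ∀ k ∈ Q, 3 / 8 ≤ r k ^ n := fun k hk => by
    have hb : 1 + (n : ℝ) * (-(5 * δ)) ≤ (1 + -(5 * δ)) ^ n :=
      one_add_mul_le_pow (by linarith) n
    have hb' : (1 + -(5 * δ)) ^ n ≤ r k ^ n :=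
      pow_le_pow_left₀ (by linarith) (by linarith [hrlb k hk]) n
    have : (n : ℝ) * (5 * δ) = 5 / 8 := by rw [← mul_assoc, mul_comm (n : ℝ), mul_assoc, hnδ]; norm_num
    linarith
  have hr0 : ∀ k, 0 ≤ r k := fun k =>
    (Summit.QuantumFields.YangMills.Theorems.EquipartitionPinsProbe.Profile.ratio_pos (hE0 k)).le
  have hw0 : ∀ k, 0 ≤ w k := fun k => Real.sqrt_nonneg _
  -- the volume of the cube
  have hvolQ : volume.real Q = δ ^ 3 := by
    rw [measureReal_def, hQ, volume_pi_pi]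
    simp only [Real.volume_Icc, Finset.prod_const, Finset.card_univ, Fintype.card_fin,
      ENNReal.toReal_pow]
    rw [ENNReal.toReal_ofReal (by linarith)]
    ring
  -- integrability
  have hint : IntegrableOn (fun k => w k * r k ^ n) (brillouin 3) volume :=
    (EquipartitionPinsProbe.Profile.continuous_weight.mul
      (EquipartitionPinsProbe.Profile.continuous_ratio.pow n)).continuousOn.integrableOn_compact
      (isCompact_brillouin 3)
  have hδ4 : 1 / (32768 * (n : ℝ) ^ 4) = δ / 8 * δ ^ 3 := by
    rw [hδ]
    field_simp
    ring
  calc 1 / (32768 * (n : ℝ) ^ 4) = ∫ _ in Q, δ / 8 := by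
        rw [setIntegral_const, hvolQ, smul_eq_mul, hδ4]
        ring
    _ ≤ ∫ k in Q, w k * r k ^ n := by
        refine setIntegral_mono_on (integrableOn_const hQcpt.measure_lt_top.ne)
          (hint.mono_set hQsub) hQmeas fun k hk => ?_
        calc δ / 8 = δ / 3 * (3 / 8) := by ring
          _ ≤ w k * r k ^ n :=
            mul_le_mul (hwlb k hk) (hrn k hk) (by norm_num) (hw0 k)
    _ ≤ ∫ k in brillouin 3, w k * r k ^ n :=
        setIntegral_mono_set hint
          (Filter.Eventually.of_forall fun k => mul_nonneg (hw0 k) (pow_nonneg (hr0 k) n))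
          (Filter.Eventually.of_forall hQsub)

/-! ### The lower bound for the kernels -/

/-- `c_n = (2/3)(2π)⁻³ J_n` for `n ≠ 0` (the tree's `stub_secondDifference`, `stub_axisFourier`,
`stub_poissonIntegral`; restated here to keep this file independent of route files). -/
theorem corr_eq_klIntegral {n : ℤ} (hn : n ≠ 0) :
    curvaturePlaquetteCorr (d := 4) (by norm_num) n =
      2 / 3 / (2 * Real.pi) ^ 3 *
        ∫ k in brillouin 3, Real.sqrt (dispersion k / (dispersion k + 2)) *
          (1 + dispersion k - Real.sqrt (dispersion k * (dispersion k + 2))) ^ n.natAbs := by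
  rw [Summit.QuantumFields.YangMills.Theorems.EquipartitionPinsProbe.stub_secondDifference n hn,
    Summit.QuantumFields.YangMills.Theorems.EquipartitionPinsProbe.stub_axisFourier
      Summit.QuantumFields.YangMills.Theorems.EquipartitionPinsProbe.stub_poissonIntegral n hn]
  ring

/-- **Polynomial lower bound for the out-of-plane axial kernel**: `c_n ≥ κ₀/n⁴` for `n ≥ 1`,
`κ₀ = (2/3)(2π)⁻³/32768`. -/
theorem corr_ge (n : ℕ) (hn : 1 ≤ n) :
    2 / 3 / (2 * Real.pi) ^ 3 / 32768 / (n : ℝ) ^ 4 ≤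
      curvaturePlaquetteCorr (d := 4) (by norm_num) (n : ℤ) := by
  have hn' : (n : ℤ) ≠ 0 := by exact_mod_cast (show n ≠ 0 by omega)
  rw [corr_eq_klIntegral hn', Int.natAbs_natCast]
  have hJ := klIntegral_ge n hn
  have hn0 : (0 : ℝ) < n := by exact_mod_cast hn
  have hc : (0 : ℝ) < 2 / 3 / (2 * Real.pi) ^ 3 := by positivity
  calc 2 / 3 / (2 * Real.pi) ^ 3 / 32768 / (n : ℝ) ^ 4
      = 2 / 3 / (2 * Real.pi) ^ 3 * (1 / (32768 * (n : ℝ) ^ 4)) := by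
        field_simp
    _ ≤ _ := mul_le_mul_of_nonneg_left hJ hc.le

/-- **Polynomial lower bound for the in-plane axial kernel**: `|curvatureTwoPoint (0;0,1) (n e₀;0,1)| ≥ κ₀/n⁴`
for `n ≥ 1`. -/
theorem abs_curvatureTwoPoint_inPlane_ge (n : ℕ) (hn : 1 ≤ n) :
    2 / 3 / (2 * Real.pi) ^ 3 / 32768 / (n : ℝ) ^ 4 ≤
      |curvatureTwoPoint (((0 : Site 4), ⟨((0 : Fin 4), (1 : Fin 4)), Fin.zero_lt_one⟩) : ZdPlaquette 4)
        (((Pi.single (0 : Fin 4) (n : ℤ) : Site 4)), ⟨((0 : Fin 4), (1 : Fin 4)), Fin.zero_lt_one⟩)| := by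
  have hn' : (n : ℤ) ≠ 0 := by exact_mod_cast (show n ≠ 0 by omega)
  rw [curvatureTwoPoint_inPlane_eq_neg_corr (n : ℤ) hn', abs_neg]
  exact (corr_ge n hn).trans (le_abs_self _)

end AxialKernel

end Summit.QuantumFields.YangMills.Theorems.LocalGaussianityExpMomentTangentLaw

end
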